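import Summits.Ventures.HodgeRepro.CyclicRecipe
import Summits.Ventures.HodgeRepro.NondegenerateNoSingleClassGeneral

/-!
# Every recipe type is degenerate (Hazama's shadow)

Blind re-derivation cell `pub-hodge-repro`, seat `p1` (gen 9).  The recipe types `Φ` of `CyclicRecipe.lean` — the base
types of the single-class `SumTwo` quadruples without a conjugate pair on `(ℤ/2rpq, rpq)` — are all DEGENERATE
(`cmRank Φ < |Φ| + 1`, i.e. the Mumford–Tate group of `A_Φ` is smaller than the maximal torus), by gen 7's
character-free Hazama shadow `HazamaShadow.not_isSingleClass_of_isNondegenerate` (a single-class `SumTwo` quadruple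
without a conjugate pair forces a degenerate base type, every finite `(G, c)`).  So the cyclic instances of the
classification are all on degenerate types, as were the degree-16 and degree-24 instances (P1.md §11–§13).
-/

set_option autoImplicit false

open Finset
open scoped Pointwise

namespace HodgeRepro.CyclicRecipe

variable {N : ℕ} [NeZero N] {r p q : ℕ}

/-- **Every recipe type is degenerate** (`¬ IsNondegenerate (Φ N r p q)`): Hazama's shadow applied to the quadruple
`T`. -/
theorem Φ_not_isNondegenerate (hN : N = 2 * (r * p * q)) (hr : 2 ≤ r) (hp : p.Prime) (hq : q.Prime) (hp2 : p ≠ 2)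
    (hq2 : q ≠ 2) (hpq : p ≠ q) : ¬ IsNondegenerate (Φ N r p q) := by
  intro hnd
  have hT0 : T N r p q 0 = Φ N r p q := T_zero
  refine HazamaShadow.not_isSingleClass_of_isNondegenerate (isComplexConj_cc hN hr hp hq) (T N r p q) ?_ ?_
    (sumTwo_T hN hr hp.pos hq.pos) (T_noConjugatePair hN hr hp hq hp2 hq2 hpq) isSingleClass_T
  · rw [hT0]; exact isCMType_Φ hN (by omega) (hp.odd_of_ne_two hp2) (hq.odd_of_ne_two hq2)
  · rw [hT0]; exact hnd

/-- The recipe's rank is at most `|Φ| = rpq` (degenerate: strictly below the maximal `|Φ| + 1`). -/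
theorem cmRank_Φ_le (hN : N = 2 * (r * p * q)) (hr : 2 ≤ r) (hp : p.Prime) (hq : q.Prime) (hp2 : p ≠ 2)
    (hq2 : q ≠ 2) (hpq : p ≠ q) : cmRank (Φ N r p q) ≤ (Φ N r p q).card := by
  have h1 := cmRank_le_half_add_one (isComplexConj_cc hN hr hp hq)
    (isCMType_Φ hN (by omega) (hp.odd_of_ne_two hp2) (hq.odd_of_ne_two hq2))
  have h2 := Φ_not_isNondegenerate hN hr hp hq hp2 hq2 hpq
  unfold IsNondegenerate at h2
  omega

end HodgeRepro.CyclicRecipe
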